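import Literature.NumberTheory.LFunctions.DworkRationalityFredholmEstimates
import Literature.NumberTheory.LFunctions.DworkRationalityFredholm
import HarnessLib

/-!
# Dwork's Fredholm determinant: finite truncations and convergence of traces (Koblitz V.3)

Part of the bottom-up proof of Dwork's rationality theorem
(`Literature/NumberTheory/LFunctions/DworkRationality.lean`), towards the named fact
`Dwork.dworkFredholmMatrix` (`…/DworkRationalityFredholm.lean`; Koblitz, GTM 58, Ch. V §3,
Lemma 4, whose infinite-matrix case Koblitz leaves as Exercise 8). With `A = (g_{qv-u})` the
matrix of `Ψ = T_q ∘ G`, `G ∈ R₀`, this file introduces the finite matrices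
`A_N = (A_{v,u})_{|v|,|u| ≤ N}` (`Dwork.truncMatrix`) and proves

* `truncMatrix_pow_apply` — the entries of `A_Nˢ` are the truncated chain sums `Dwork.dworkPowIn`;
* `coeffTrace_eq_tsum` — Koblitz's `Tr(Ψˢ) = c_s = ∑_v (Aˢ)_{v,v}` (`Dwork.coeffTrace`, via
  `dworkPow_diag`), an absolutely convergent sum;
* `norm_trace_pow_sub_coeffTrace_le` — `‖Tr(A_Nˢ) - c_s‖ ≤ ρ^{(q-1)(N+1)}`, hence
  `tendsto_trace_truncMatrix_pow : Tr(A_Nˢ) → c_s` as `N → ∞` (`s ≥ 1`).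

## References

* N. Koblitz, *p-adic Numbers, p-adic Analysis, and Zeta-Functions*, 2nd ed., GTM 58 (1984),
  Ch. V §3, pp. 129–131, and §4 Ex. 8. [Koblitz1984]
-/

open Filter Finset MvPowerSeries

noncomputable section

namespace Literature.NumberTheory.LFunctions

namespace Dwork

/-! ### The finite matrices `A_N` -/

section Truncation

variable {ι : Type*} [Finite ι] {R : Type*} [CommRing R]

/-- The exponents of degree `≤ N`, a finite type indexing the truncation `A_N`. [folklore] -/
abbrev DegLE (ι : Type*) (N : ℕ) : Type _ := {u : ι →₀ ℕ // Finsupp.degree u ≤ N}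

/-- `DegLE ι N` is finite (`Finsupp.finite_of_degree_le`); we fix its classical `Fintype`
structure (an instance on our own subtype). [folklore] -/
instance fintypeDegLE (N : ℕ) : Fintype (DegLE ι N) :=
  haveI : Finite (DegLE ι N) := (Finsupp.finite_of_degree_le (σ := ι) N).to_subtype
  Fintype.ofFinite _

/-- The finite truncation `A_N = (A_{v,u})_{|v|,|u| ≤ N}` of the matrix of `Ψ_{q,G}` (Koblitz,
Ch. V §3, p. 131: Lemma 4 is proved for finite matrices and extended to `A` by a limit). [cite: Koblitz1984, Ch. V §3 Lemma 4] -/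
def truncMatrix (N q : ℕ) (G : MvPowerSeries ι R) : Matrix (DegLE ι N) (DegLE ι N) R :=
  Matrix.of fun v u => dworkEntry q G v.1 u.1

open Classical in
/-- **The entries of `A_Nˢ` are the truncated chain sums** `dworkPowIn N q G s`. [folklore] -/
theorem truncMatrix_pow_apply (N q : ℕ) (G : MvPowerSeries ι R) (s : ℕ) (v u : DegLE ι N) :
    (truncMatrix N q G ^ s) v u = dworkPowIn N q G s v.1 u.1 := by
  induction s generalizing v with
  | zero =>
    rw [pow_zero, Matrix.one_apply, dworkPowIn_zero]
    simp only [Subtype.ext_iff]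
  | succ s ih =>
    rw [pow_succ', Matrix.mul_apply, dworkPowIn_succ]
    simp_rw [ih]
    -- reindex the non-zero terms: `w ↦ (q v - w, w)`
    refine Finset.sum_bij_ne_zero (fun w _ _ => (q • v.1 - w.1, w.1)) ?_ ?_ ?_ ?_
    · intro w _ hw
      have hle : w.1 ≤ q • v.1 := by
        by_contra h
        exact hw (by rw [truncMatrix, Matrix.of_apply, dworkEntry, if_neg h, zero_mul])
      rw [mem_filter, mem_antidiagonal]
      exact ⟨tsub_add_cancel_of_le hle, w.2⟩
    · intro w _ _ w' _ _ h
      exact Subtype.ext (congrArg Prod.snd h)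
    · intro x hx hne
      rw [mem_filter, mem_antidiagonal] at hx
      refine ⟨⟨x.2, hx.2⟩, mem_univ _, ?_, ?_⟩
      · have hle : x.2 ≤ q • v.1 := by rw [← hx.1]; exact le_add_self
        rw [truncMatrix, Matrix.of_apply, dworkEntry, if_pos hle,
          show q • v.1 - x.2 = x.1 from (eq_tsub_of_add_eq hx.1).symm]
        exact hne
      · exact Prod.ext (eq_tsub_of_add_eq hx.1).symm rfl
    · intro w _ hw
      have hle : w.1 ≤ q • v.1 := by
        by_contra h
        exact hw (by rw [truncMatrix, Matrix.of_apply, dworkEntry, if_neg h, zero_mul])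
      rw [truncMatrix, Matrix.of_apply, dworkEntry, if_pos hle]

open Classical in
/-- `Tr(A_Nˢ) = ∑_{|v| ≤ N} (A_Nˢ)_{v,v}`. [folklore] -/
theorem trace_truncMatrix_pow (N q : ℕ) (G : MvPowerSeries ι R) (s : ℕ) :
    Matrix.trace (truncMatrix N q G ^ s) = ∑ v : DegLE ι N, dworkPowIn N q G s v.1 v.1 := by
  rw [Matrix.trace]
  exact Finset.sum_congr rfl fun v _ => truncMatrix_pow_apply N q G s v v

end Truncation

/-! ### `Tr(A_Nˢ) → Tr(Ψˢ)` -/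

/-- **`Tr(Ψˢ) = ∑_v (Aˢ)_{v,v}`**: Koblitz's trace numbers in coefficient form (`Dwork.coeffTrace`)
are the sums of the diagonal entries of the powers of `A` (`dworkPow_diag`). [cite: Koblitz1984, Ch. V §3 Lemma 3] -/
theorem coeffTrace_eq_tsum {p : ℕ} [Fact p.Prime] {ι : Type*} (G : MvPowerSeries ι ℂ_[p]) {q : ℕ}
    (hq : q ≠ 0) (s : ℕ) :
    coeffTrace p q hq G s = ∑' v : ι →₀ ℕ, dworkPow q G s v v :=
  tsum_congr fun v => (dworkPow_diag hq G s v).symm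

section Limit

variable {p : ℕ} [Fact p.Prime] {ι : Type*} [Fintype ι]
variable {G : MvPowerSeries ι ℂ_[p]} {ρ : ℝ} (hρ0 : 0 ≤ ρ) (hρ1 : ρ < 1)
  (hG : ∀ w : ι →₀ ℕ, ‖coeff w G‖ ≤ ρ ^ Finsupp.degree w)

include hρ0 hρ1 hG in
/-- The diagonal `v ↦ (Aˢ)_{v,v}` is summable for `q ≥ 2`, `s ≥ 1` (its terms have norm
`≤ ρ^{(q-1)|v|}`, `norm_dworkPow_diag_le`; Koblitz, p. 129: "`Tr Ψ = ∑ g_{(q-1)u}`, which clearly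
converges by the definition of `R₀`"). [cite: Koblitz1984, Ch. V §3] -/
theorem summable_dworkPow_diag {q : ℕ} (hq : 2 ≤ q) {s : ℕ} (hs : 0 < s) :
    Summable fun v : ι →₀ ℕ => dworkPow q G s v v := by
  refine NonarchimedeanAddGroup.summable_of_tendsto_cofinite_zero ?_
  rw [NormedAddGroup.tendsto_nhds_zero]
  intro ε hε
  obtain ⟨d, hd⟩ := exists_pow_lt_of_lt_one hε hρ1
  rw [Filter.eventually_cofinite]
  refine (Finsupp.finite_of_degree_le d).subset fun v hv => ?_
  rw [Set.mem_setOf_eq, not_lt] at hv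
  by_contra hdeg
  rw [Set.mem_setOf_eq, not_le] at hdeg
  have h1 : ‖dworkPow q G s v v‖ ≤ ρ ^ ((q - 1) * Finsupp.degree v) :=
    norm_dworkPow_diag_le hρ0 hρ1.le hG (by omega) hs v
  have h2 : ρ ^ ((q - 1) * Finsupp.degree v) ≤ ρ ^ d := by
    apply pow_le_pow_of_le_one hρ0 hρ1.le
    calc d ≤ Finsupp.degree v := hdeg.le
      _ ≤ (q - 1) * Finsupp.degree v := Nat.le_mul_of_pos_left _ (by omega)
  exact absurd (hv.trans (h1.trans h2)) (not_le.mpr hd)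

include hρ0 hρ1 hG in
open Classical in
/-- **`‖Tr(A_Nˢ) - Tr(Ψˢ)‖ ≤ ρ^{(q-1)(N+1)}`** (`q ≥ 2`, `s ≥ 1`): on the diagonal of the
truncation the entries of `Aˢ` and `A_Nˢ` differ by `≤ ρ^{(q-1)(N+1)}` (`norm_dworkPow_diag_sub_le`),
and the diagonal entries of `Aˢ` of degree `> N` are that small too (`norm_dworkPow_diag_le`);
the ultrametric inequality bounds the finite sum and the tail. This is the convergence
`Tr(A_Nˢ) → Tr(Aˢ)` in Koblitz's extension of Lemma 4 to infinite matrices (Ch. V §3, p. 131;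
§4 Ex. 8). [cite: Koblitz1984, Ch. V §3 Lemma 4] -/
theorem norm_trace_pow_sub_coeffTrace_le {q : ℕ} (hq : 2 ≤ q) {s : ℕ} (hs : 0 < s) (N : ℕ) :
    ‖Matrix.trace (truncMatrix N q G ^ s) - coeffTrace p q (by omega) G s‖ ≤
      ρ ^ ((q - 1) * (N + 1)) := by
  classical
  have hq1 : 1 ≤ q := by omega
  set F : Finset (ι →₀ ℕ) := (Finsupp.finite_of_degree_le (σ := ι) N).toFinset with hF
  have hmemF : ∀ v : ι →₀ ℕ, v ∈ F ↔ Finsupp.degree v ≤ N := fun v => by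
    rw [hF, Set.Finite.mem_toFinset, Set.mem_setOf_eq]
  -- `c_s = ∑_{v ∈ F} (Aˢ)_{v,v} + ∑_{v ∉ F} (Aˢ)_{v,v}`
  have hsplit := (summable_dworkPow_diag hρ0 hρ1 hG hq hs).sum_add_tsum_compl (s := F)
  -- `Tr(A_Nˢ) = ∑_{v ∈ F} (A_Nˢ)_{v,v}`
  have htrace : Matrix.trace (truncMatrix N q G ^ s) =
      ∑ v ∈ F, dworkPowIn N q G s v v := by
    rw [trace_truncMatrix_pow, ← Finset.sum_subtype F hmemF (fun v => dworkPowIn N q G s v v)]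
  rw [coeffTrace_eq_tsum G (by omega) s, ← hsplit, htrace, ← sub_sub, ← Finset.sum_sub_distrib,
    sub_eq_add_neg]
  refine (IsUltrametricDist.norm_add_le_max _ _).trans (max_le ?_ ?_)
  · refine IsUltrametricDist.norm_sum_le_of_forall_le_of_nonneg (pow_nonneg hρ0 _) fun v hv => ?_
    rw [← norm_neg, neg_sub]
    exact norm_dworkPow_diag_sub_le hρ0 hρ1.le hG N hq1 hs ((hmemF v).mp hv)
  · rw [norm_neg]
    refine IsUltrametricDist.norm_tsum_le_of_forall_le_of_nonneg (pow_nonneg hρ0 _) fun v => ?_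
    have hv : N < Finsupp.degree v.1 := by
      have := v.2
      rw [Set.mem_compl_iff, Finset.mem_coe, hmemF, not_le] at this
      exact this
    refine (norm_dworkPow_diag_le hρ0 hρ1.le hG hq1 hs v.1).trans ?_
    exact pow_le_pow_of_le_one hρ0 hρ1.le (Nat.mul_le_mul_left _ hv)

include hρ0 hρ1 hG in
open Classical in
/-- **`Tr(A_Nˢ) → Tr(Ψˢ)`** as `N → ∞` (`q ≥ 2`, `s ≥ 1`). [cite: Koblitz1984, Ch. V §3 Lemma 4] -/
theorem tendsto_trace_truncMatrix_pow {q : ℕ} (hq : 2 ≤ q) {s : ℕ} (hs : 0 < s) :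
    Tendsto (fun N => Matrix.trace (truncMatrix N q G ^ s)) atTop
      (nhds (coeffTrace p q (by omega) G s)) := by
  rw [← tendsto_sub_nhds_zero_iff]
  refine squeeze_zero_norm (fun N => norm_trace_pow_sub_coeffTrace_le hρ0 hρ1 hG hq hs N) ?_
  have hρq : ρ ^ (q - 1) < 1 := pow_lt_one₀ hρ0 hρ1 (by omega)
  have := (tendsto_pow_atTop_nhds_zero_of_lt_one (pow_nonneg hρ0 _) hρq).comp
    (tendsto_add_atTop_nat 1)
  refine this.congr fun N => ?_
  rw [Function.comp_apply, ← pow_mul]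

end Limit

end Dwork

end Literature.NumberTheory.LFunctions
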